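import Summits.CriticalPhenomena.PercolationContinuityZ3.Theorems.Transplant.FKConnectivityAllQAntipodalTwoSpinePhiWeight
import Summits.CriticalPhenomena.PercolationContinuityZ3.Theorems.Transplant.FKConnectivityAllQAntipodalTwoSpinePhiRows
import HarnessLib

/-!
# Connectivity correlation inequalities for `φ_{w,q}` — TWO-SPINE word model: THEOREM U ON `A∖y` AT THE WORD LEVEL (`Φ_{A∖y} = phiRun (false,false)`)

Helper file (`--supports stmt-CriticalPhenomena-4575`), FK sub-lane `prim-bschramm-fk-2` (gen 15); builds on p205010 (kernel theorem,
internal audit signed; external expert review pending).  No named facts, no sorries, standard axioms.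

Memo `bschramm/FROM-fk-2-g15-TWO-SPINE.md` §11 (R2) / §12 (V2): the degree-0 atoms of a critical cell are sent along Theorem U's injection for
the side with its marked edge DELETED, i.e. `phiRun` from the root `00`: it never reaches the root (`phiReachesRoot_deleted`), turns
`(rowC α, rowC ᾱ) = (false, true)` into `(true, false)` (`rowC_phiDel`) and preserves `corr α + corr ᾱ` (`rowCorr_phiDel`); injectivity is
`phiRun_injective` (`…TwoSpinePhiInj`) with `topComp_deleted`.
[cite: Grimmett2006, §3.8 (pp. 61–62); §3.9 (p. 63)]
-/

namespace Summit.CriticalPhenomena.PercolationContinuityZ3.Theorems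

namespace FK

namespace TwoSpine

open X2Word

/-! ### Theorem U on `A∖y` at the word level: `phiRun` from the DELETED root `00` (the map `Φ_{A∖y}` of the two-spine rule) -/

/-- From the deleted root the run never reaches the root. [folklore] -/
theorem phiReachesRoot_deleted (u : List SLetter) : phiReachesRoot (false, false) u = false := by
  simp [phiReachesRoot, is01]

/-- The side weight from the deleted root is the total `corr` of the two rows. [folklore] -/
theorem sideWeight_deleted (u : List SLetter) : sideWeight (false, false) u = rowCorr (sRowA u) + rowCorr (sRowB u) := by
  simp [sideWeight]

/-- **`Φ_{A∖y}` lands on winners**: if `α` does not conduct and `ᾱ` conducts, then after `phiRun (false,false)` the row `α'` conducts and `ᾱ'`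
does not (Theorem U's injection for the side with its marked edge deleted). [folklore] -/
theorem rowC_phiDel {u : List SLetter} (ha : rowC (sRowA u) = false) (hab : rowC (sRowB u) = true) :
    rowC (sRowA (phiRun (false, false) u)) = true ∧ rowC (sRowB (phiRun (false, false) u)) = false := by
  have h01 : topComp (false, false) u = (false, true) := by rw [topComp_deleted, ha, hab]
  have h := topComp_phiRun h01 (phiReachesRoot_deleted u)
  rw [topComp_deleted] at h
  exact ⟨(Prod.mk.inj h).1, (Prod.mk.inj h).2⟩

/-- **`Φ_{A∖y}` preserves `corr`**. [folklore] -/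
theorem rowCorr_phiDel {u : List SLetter} (ha : rowC (sRowA u) = false) (hab : rowC (sRowB u) = true) :
    rowCorr (sRowA (phiRun (false, false) u)) + rowCorr (sRowB (phiRun (false, false) u)) = rowCorr (sRowA u) + rowCorr (sRowB u) := by
  have h01 : topComp (false, false) u = (false, true) := by rw [topComp_deleted, ha, hab]
  have h := sideWeight_phiRun h01 (phiReachesRoot_deleted u)
  rwa [sideWeight_deleted, sideWeight_deleted] at h

end TwoSpine

end FK

end Summit.CriticalPhenomena.PercolationContinuityZ3.Theorems
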